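import Summits.AtomisticToContinuum.HydrodynamicLimit.Theorems.RelayRaceLocalityConeLocalisationBubbleHypDefs
import Literature.Analysis.FluidPDE.HardSphereRegularGeometry
import Literature.MathematicalPhysics.KineticTheory.HardSphereEulerDim
import HarnessLib

/-!
# RelayRaceLocality · ConeLocalisation — bubble stub, helper (AP) part A: zoom calculus of bubbles and small lemmas

Helper file (part A of three) for the lead-held stub `stub_bubble : BubbleAtScale` of line `Sketch`
(zoomed-bubble-transplant) of the crux item `stmt-AtomisticToContinuum-12504` (`ConeLocalisation`), lead
prover-line-stmt-AtomisticToContinuum-12504-0 (2026-08-17). The bubble lemma is assembled in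
`…BubbleAssembly.lean` (bootstrap a-priori estimate `…BubbleAssemblyB.lean` + existence) from the five typed inputs of
`…BubbleHypDefs.lean`. This part: locality of `Torus.partialDeriv`, the ITERATED zoom dictionary (first three nested
derivatives of `f ∘ Z` from the first-order dictionary of `ZoomHyp`), the bound `D3 ≤ 81270900 (κr)²` of the zoomed
data energy of a bubble with `ScaleDeviation` bounds (`|∂ᵏ(f ∘ Z)| ≤ (10r)ᵏ κ r^{1-k} = 10ᵏ κ r`, unit volume of `𝕋³`),
two arithmetic lemmas on the guarded box and the packing fraction, and the trivial bubble `κ = 0`.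
-/

noncomputable section

namespace Summit.AtomisticToContinuum.HydrodynamicLimit.Theorems.ConeLocalisation.Bubble

open Set MeasureTheory Filter Topology
open Literature.MathematicalPhysics.KineticTheory Literature.Analysis.FluidPDE
  Literature.Analysis.FunctionSpaces
open Summit.AtomisticToContinuum.HydrodynamicLimit.Theorems.ConeLocalisation

/-! ## Locality and elementary calculus of `Torus.partialDeriv` -/

/-- **Locality of `Torus.partialDeriv`**: a function equal to a constant on an open set of `𝕋³` has
vanishing partial derivatives there (the coordinate-line restriction is eventually constant). -/
theorem ap_partialDeriv_eq_zero_of_isOpen {F : Type*} [NormedAddCommGroup F] [NormedSpace ℝ F]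
    {U : Set T3} (hU : IsOpen U) {f : T3 → F} {b : F} (hf : ∀ x ∈ U, f x = b) (i : Fin 3) :
    ∀ x ∈ U, Torus.partialDeriv i f x = 0 := by
  intro x hx
  have hc : Tendsto (fun t : ℝ => x + Torus.proj (t • EuclideanSpace.single i (1 : ℝ))) (𝓝 0) (𝓝 x) := by
    have hcont : Continuous fun t : ℝ => x + Torus.proj (t • EuclideanSpace.single i (1 : ℝ)) :=
      continuous_const.add (Torus.continuous_proj.comp (continuous_id.smul continuous_const))
    have h0 := hcont.continuousAt (x := 0)
    rwa [ContinuousAt, zero_smul, Torus.proj_zero, add_zero] at h0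
  have hev : (fun t : ℝ => f (x + Torus.proj (t • EuclideanSpace.single i (1 : ℝ)))) =ᶠ[𝓝 0]
      fun _ => b :=
    hc.eventually (Filter.eventually_of_mem (hU.mem_nhds hx) hf)
  unfold Torus.partialDeriv Torus.lineDeriv
  rw [hev.deriv_eq]
  simp

/-- The exterior `{x | c < d(x, x₀)}` of a minimal-image ball is open (continuity of the minimal-image distance,
`Torus.continuous_euclidDist`). -/
theorem ap_isOpen_far (x₀ : T3) (c : ℝ) : IsOpen {x : T3 | c < Torus.euclidDist x x₀} := by
  have h := (Torus.continuous_euclidDist (d := Fin 3)).comp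
    ((continuous_id (X := T3)).prodMk (continuous_const (y := x₀)))
  have hc : Continuous fun x : T3 => Torus.euclidDist x x₀ := by simpa only [Function.comp_def, id] using h
  exact isOpen_lt continuous_const hc

/-- Constants factor out of `Torus.partialDeriv` (scalar, no differentiability needed). -/
theorem ap_partialDeriv_const_mul (c : ℝ) (g : T3 → ℝ) (i : Fin 3) (y : T3) :
    Torus.partialDeriv i (fun x => c * g x) y = c * Torus.partialDeriv i g y := by
  show deriv (fun t : ℝ => c * g (y + Torus.proj (t • EuclideanSpace.single i (1 : ℝ)))) 0 =
    c * deriv (fun t : ℝ => g (y + Torus.proj (t • EuclideanSpace.single i (1 : ℝ)))) 0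
  exact deriv_const_mul_field c

/-- Constants factor out of `Torus.partialDeriv` (vector, no differentiability needed). -/
theorem ap_partialDeriv_const_smul (c : ℝ) (w : T3 → V3) (i : Fin 3) (y : T3) :
    Torus.partialDeriv i (fun x => c • w x) y = c • Torus.partialDeriv i w y := by
  show deriv (fun t : ℝ => c • w (y + Torus.proj (t • EuclideanSpace.single i (1 : ℝ)))) 0 =
    c • deriv (fun t : ℝ => w (y + Torus.proj (t • EuclideanSpace.single i (1 : ℝ)))) 0
  exact deriv_fun_const_smul_field c _

/-! ## The iterated zoom dictionary and the zoomed data energy -/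

/-- On the probability space `𝕋³`, a pointwise bound `|g| ≤ B` gives `∫ g² ≤ B²`. -/
theorem ap_integral_sq_le {g : T3 → ℝ} {B : ℝ} (h : ∀ y, |g y| ≤ B) : ∫ y, g y ^ 2 ≤ B ^ 2 := by
  have h2 : ∀ y, ‖g y ^ 2‖ ≤ B ^ 2 := fun y => by
    rw [Real.norm_eq_abs, abs_pow]
    exact pow_le_pow_left₀ (abs_nonneg _) (h y) 2
  have h3 := norm_integral_le_of_norm_le_const (μ := volume) (Filter.Eventually.of_forall h2)
  rw [probReal_univ, mul_one, Real.norm_eq_abs] at h3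
  exact (le_abs_self _).trans h3

/-- On the probability space `𝕋³`, a pointwise bound `‖w‖ ≤ B` gives `∫ ‖w‖² ≤ B²`. -/
theorem ap_integral_norm_sq_le {w : T3 → V3} {B : ℝ} (h : ∀ y, ‖w y‖ ≤ B) :
    ∫ y, ‖w y‖ ^ 2 ≤ B ^ 2 := by
  have h2 : ∀ y, ‖‖w y‖ ^ 2‖ ≤ B ^ 2 := fun y => by
    rw [Real.norm_eq_abs, abs_pow, abs_norm]
    exact pow_le_pow_left₀ (norm_nonneg _) (h y) 2
  have h3 := norm_integral_le_of_norm_le_const (μ := volume) (Filter.Eventually.of_forall h2)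
  rw [probReal_univ, mul_one, Real.norm_eq_abs] at h3
  exact (le_abs_self _).trans h3

/-- **Iterated zoom dictionary, scalar.** If `Z` obeys the scalar zoom dictionary at `(m, a, x₀)` and the smooth
`f` equals `b` on an open `U ⊇ {a ≤ d(·, x₀)}`, then the first three nested derivatives of `f ∘ Z` are
`m^{-k}` times those of `f` at `Z`. -/
theorem ap_zoom_derivs {m a : ℝ} {x₀ : T3} {Z : T3 → T3}
    (hZs : ∀ (g : T3 → ℝ) (c : ℝ), Torus.IsSmooth g → (∀ x, a ≤ Torus.euclidDist x x₀ → g x = c) →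
      Torus.IsSmooth (fun y => g (Z y)) ∧
      (∀ y (i : Fin 3), Torus.partialDeriv i (fun y => g (Z y)) y = m⁻¹ * Torus.partialDeriv i g (Z y)) ∧
      (∀ y, m * a ≤ Torus.euclidDist y x₀ → g (Z y) = c))
    {f : T3 → ℝ} {b : ℝ} (hf : Torus.IsSmooth f) {U : Set T3} (hU : IsOpen U)
    (haU : ∀ x, a ≤ Torus.euclidDist x x₀ → x ∈ U) (hfU : ∀ x ∈ U, f x = b) (y : T3) (i j k : Fin 3) :
    Torus.partialDeriv i (fun y => f (Z y)) y = m⁻¹ * Torus.partialDeriv i f (Z y) ∧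
    Torus.partialDeriv i (Torus.partialDeriv j (fun y => f (Z y))) y =
      m⁻¹ * (m⁻¹ * Torus.partialDeriv i (Torus.partialDeriv j f) (Z y)) ∧
    Torus.partialDeriv i (Torus.partialDeriv j (Torus.partialDeriv k (fun y => f (Z y)))) y =
      m⁻¹ * (m⁻¹ * (m⁻¹ * Torus.partialDeriv i (Torus.partialDeriv j (Torus.partialDeriv k f)) (Z y))) := by
  have hd1 : ∀ l, ∀ x ∈ U, Torus.partialDeriv l f x = 0 := fun l =>
    ap_partialDeriv_eq_zero_of_isOpen hU hfU l
  have hd2 : ∀ l l', ∀ x ∈ U, Torus.partialDeriv l (Torus.partialDeriv l' f) x = 0 := fun l l' =>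
    ap_partialDeriv_eq_zero_of_isOpen hU (hd1 l') l
  have D0 := (hZs f b hf fun x hx => hfU x (haU x hx)).2.1
  have D1 : ∀ l y (i : Fin 3), Torus.partialDeriv i (fun y => Torus.partialDeriv l f (Z y)) y =
      m⁻¹ * Torus.partialDeriv i (Torus.partialDeriv l f) (Z y) := fun l =>
    (hZs _ 0 (hf.partialDeriv l) fun x hx => hd1 l x (haU x hx)).2.1
  have D2 : ∀ l l' y (i : Fin 3),
      Torus.partialDeriv i (fun y => Torus.partialDeriv l (Torus.partialDeriv l' f) (Z y)) y =
      m⁻¹ * Torus.partialDeriv i (Torus.partialDeriv l (Torus.partialDeriv l' f)) (Z y) := fun l l' =>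
    (hZs _ 0 ((hf.partialDeriv l').partialDeriv l) fun x hx => hd2 l l' x (haU x hx)).2.1
  have E0 : ∀ l, Torus.partialDeriv l (fun y => f (Z y)) = fun y => m⁻¹ * Torus.partialDeriv l f (Z y) :=
    fun l => funext fun y => D0 y l
  have E1 : ∀ l l', Torus.partialDeriv l (Torus.partialDeriv l' (fun y => f (Z y))) =
      fun y => m⁻¹ * (m⁻¹ * Torus.partialDeriv l (Torus.partialDeriv l' f) (Z y)) := by
    intro l l'
    funext y
    rw [E0 l', ap_partialDeriv_const_mul, D1 l' y l]
  refine ⟨D0 y i, by rw [E1], ?_⟩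
  rw [E1 j k, ap_partialDeriv_const_mul, ap_partialDeriv_const_mul, D2 j k y i]

/-- **Iterated zoom dictionary, vector.** -/
theorem ap_zoom_derivsV {m a : ℝ} {x₀ : T3} {Z : T3 → T3}
    (hZv : ∀ (w : T3 → V3) (c : V3), Torus.IsSmooth w → (∀ x, a ≤ Torus.euclidDist x x₀ → w x = c) →
      Torus.IsSmooth (fun y => w (Z y)) ∧
      (∀ y (i : Fin 3), Torus.partialDeriv i (fun y => w (Z y)) y = m⁻¹ • Torus.partialDeriv i w (Z y)) ∧
      (∀ y, m * a ≤ Torus.euclidDist y x₀ → w (Z y) = c))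
    {w : T3 → V3} {b : V3} (hw : Torus.IsSmooth w) {U : Set T3} (hU : IsOpen U)
    (haU : ∀ x, a ≤ Torus.euclidDist x x₀ → x ∈ U) (hwU : ∀ x ∈ U, w x = b) (y : T3) (i j k : Fin 3) :
    Torus.partialDeriv i (fun y => w (Z y)) y = m⁻¹ • Torus.partialDeriv i w (Z y) ∧
    Torus.partialDeriv i (Torus.partialDeriv j (fun y => w (Z y))) y =
      m⁻¹ • (m⁻¹ • Torus.partialDeriv i (Torus.partialDeriv j w) (Z y)) ∧
    Torus.partialDeriv i (Torus.partialDeriv j (Torus.partialDeriv k (fun y => w (Z y)))) y =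
      m⁻¹ • (m⁻¹ • (m⁻¹ • Torus.partialDeriv i (Torus.partialDeriv j (Torus.partialDeriv k w)) (Z y))) := by
  have hd1 : ∀ l, ∀ x ∈ U, Torus.partialDeriv l w x = 0 := fun l =>
    ap_partialDeriv_eq_zero_of_isOpen hU hwU l
  have hd2 : ∀ l l', ∀ x ∈ U, Torus.partialDeriv l (Torus.partialDeriv l' w) x = 0 := fun l l' =>
    ap_partialDeriv_eq_zero_of_isOpen hU (hd1 l') l
  have D0 := (hZv w b hw fun x hx => hwU x (haU x hx)).2.1
  have D1 : ∀ l y (i : Fin 3), Torus.partialDeriv i (fun y => Torus.partialDeriv l w (Z y)) y =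
      m⁻¹ • Torus.partialDeriv i (Torus.partialDeriv l w) (Z y) := fun l =>
    (hZv _ 0 (hw.partialDeriv l) fun x hx => hd1 l x (haU x hx)).2.1
  have D2 : ∀ l l' y (i : Fin 3),
      Torus.partialDeriv i (fun y => Torus.partialDeriv l (Torus.partialDeriv l' w) (Z y)) y =
      m⁻¹ • Torus.partialDeriv i (Torus.partialDeriv l (Torus.partialDeriv l' w)) (Z y) := fun l l' =>
    (hZv _ 0 ((hw.partialDeriv l').partialDeriv l) fun x hx => hd2 l l' x (haU x hx)).2.1
  have E0 : ∀ l, Torus.partialDeriv l (fun y => w (Z y)) = fun y => m⁻¹ • Torus.partialDeriv l w (Z y) :=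
    fun l => funext fun y => D0 y l
  have E1 : ∀ l l', Torus.partialDeriv l (Torus.partialDeriv l' (fun y => w (Z y))) =
      fun y => m⁻¹ • (m⁻¹ • Torus.partialDeriv l (Torus.partialDeriv l' w) (Z y)) := by
    intro l l'
    funext y
    rw [E0 l', ap_partialDeriv_const_smul, D1 l' y l]
  refine ⟨D0 y i, by rw [E1], ?_⟩
  rw [E1 j k, ap_partialDeriv_const_smul, ap_partialDeriv_const_smul, D2 j k y i]

/-- **Energy of zoomed data, scalar.** With `m⁻¹ = 10 r`, a field with `ScaleDeviation` bounds of slope `κ` at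
scale `r`, constant outside an open `U ⊇ {a ≤ d(·, x₀)}`, has zoomed derivative energy `fieldD3 (f ∘ Z) ≤ 27090300 (κr)²`
(`|∂ᵏ(f ∘ Z)| ≤ (10 r)ᵏ κ r^{1-k} = 10ᵏ κ r`, unit volume of `𝕋³`, `3·10² + 9·10⁴ + 27·10⁶ = 27090300`). -/
theorem ap_fieldD3_zoom_le {m a r κ : ℝ} {x₀ : T3} {Z : T3 → T3}
    (hZs : ∀ (g : T3 → ℝ) (c : ℝ), Torus.IsSmooth g → (∀ x, a ≤ Torus.euclidDist x x₀ → g x = c) →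
      Torus.IsSmooth (fun y => g (Z y)) ∧
      (∀ y (i : Fin 3), Torus.partialDeriv i (fun y => g (Z y)) y = m⁻¹ * Torus.partialDeriv i g (Z y)) ∧
      (∀ y, m * a ≤ Torus.euclidDist y x₀ → g (Z y) = c))
    {f : T3 → ℝ} {b : ℝ} (hf : Torus.IsSmooth f) {U : Set T3} (hU : IsOpen U)
    (haU : ∀ x, a ≤ Torus.euclidDist x x₀ → x ∈ U) (hfU : ∀ x ∈ U, f x = b)
    (hdev : ScaleDeviation f b r κ) (hm : m⁻¹ = 10 * r) (hr : 0 < r) :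
    fieldD3 (fun y => f (Z y)) ≤ 27090300 * (κ * r) ^ 2 := by
  have h10 : 0 < 10 * r := by positivity
  have P1 : ∀ y l, |Torus.partialDeriv l (fun y => f (Z y)) y| ≤ 10 * (κ * r) := by
    intro y l
    rw [(ap_zoom_derivs hZs hf hU haU hfU y l l l).1, abs_mul, hm, abs_of_pos h10]
    have h := ((hdev (Z y)).2 l l l).1
    calc 10 * r * |Torus.partialDeriv l f (Z y)| ≤ 10 * r * κ := by gcongr
      _ = 10 * (κ * r) := by ring
  have P2 : ∀ y i l, |Torus.partialDeriv i (Torus.partialDeriv l (fun y => f (Z y))) y| ≤ 100 * (κ * r) := by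
    intro y i l
    rw [(ap_zoom_derivs hZs hf hU haU hfU y i l l).2.1, abs_mul, abs_mul, hm, abs_of_pos h10]
    have h := ((hdev (Z y)).2 i l l).2.1
    calc 10 * r * (10 * r * |Torus.partialDeriv i (Torus.partialDeriv l f) (Z y)|)
        ≤ 10 * r * (10 * r * (κ / r)) := by gcongr
      _ = 100 * (κ * r) := by field_simp; ring
  have P3 : ∀ y j i l,
      |Torus.partialDeriv j (Torus.partialDeriv i (Torus.partialDeriv l (fun y => f (Z y)))) y| ≤
        1000 * (κ * r) := by
    intro y j i l
    rw [(ap_zoom_derivs hZs hf hU haU hfU y j i l).2.2, abs_mul, abs_mul, abs_mul, hm, abs_of_pos h10]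
    have h := ((hdev (Z y)).2 j i l).2.2
    calc 10 * r * (10 * r * (10 * r *
          |Torus.partialDeriv j (Torus.partialDeriv i (Torus.partialDeriv l f)) (Z y)|))
        ≤ 10 * r * (10 * r * (10 * r * (κ / r ^ 2))) := by gcongr
      _ = 1000 * (κ * r) := by field_simp; ring
  have I1 : ∀ l, ∫ y, Torus.partialDeriv l (fun y => f (Z y)) y ^ 2 ≤ 100 * (κ * r) ^ 2 := fun l =>
    (ap_integral_sq_le fun y => P1 y l).trans_eq (by ring)
  have I2 : ∀ i l, ∫ y, Torus.partialDeriv i (Torus.partialDeriv l (fun y => f (Z y))) y ^ 2 ≤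
      10000 * (κ * r) ^ 2 := fun i l => (ap_integral_sq_le fun y => P2 y i l).trans_eq (by ring)
  have I3 : ∀ j i l,
      ∫ y, Torus.partialDeriv j (Torus.partialDeriv i (Torus.partialDeriv l (fun y => f (Z y)))) y ^ 2 ≤
      1000000 * (κ * r) ^ 2 := fun j i l => (ap_integral_sq_le fun y => P3 y j i l).trans_eq (by ring)
  have S1 : ∑ l : Fin 3, ∫ y, Torus.partialDeriv l (fun y => f (Z y)) y ^ 2 ≤
      ∑ _l : Fin 3, 100 * (κ * r) ^ 2 := Finset.sum_le_sum fun l _ => I1 l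
  have S2 : ∑ i : Fin 3, ∑ l : Fin 3, ∫ y, Torus.partialDeriv i (Torus.partialDeriv l (fun y => f (Z y))) y ^ 2 ≤
      ∑ _i : Fin 3, ∑ _l : Fin 3, 10000 * (κ * r) ^ 2 :=
    Finset.sum_le_sum fun i _ => Finset.sum_le_sum fun l _ => I2 i l
  have S3 : ∑ j : Fin 3, ∑ i : Fin 3, ∑ l : Fin 3,
      ∫ y, Torus.partialDeriv j (Torus.partialDeriv i (Torus.partialDeriv l (fun y => f (Z y)))) y ^ 2 ≤
      ∑ _j : Fin 3, ∑ _i : Fin 3, ∑ _l : Fin 3, 1000000 * (κ * r) ^ 2 :=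
    Finset.sum_le_sum fun j _ => Finset.sum_le_sum fun i _ => Finset.sum_le_sum fun l _ => I3 j i l
  simp only [Finset.sum_const, Finset.card_univ, Fintype.card_fin, nsmul_eq_mul, Nat.cast_ofNat] at S1 S2 S3
  unfold fieldD3
  linarith

/-- **Energy of zoomed data, vector.** -/
theorem ap_fieldD3V_zoom_le {m a r κ : ℝ} {x₀ : T3} {Z : T3 → T3}
    (hZv : ∀ (w : T3 → V3) (c : V3), Torus.IsSmooth w → (∀ x, a ≤ Torus.euclidDist x x₀ → w x = c) →
      Torus.IsSmooth (fun y => w (Z y)) ∧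
      (∀ y (i : Fin 3), Torus.partialDeriv i (fun y => w (Z y)) y = m⁻¹ • Torus.partialDeriv i w (Z y)) ∧
      (∀ y, m * a ≤ Torus.euclidDist y x₀ → w (Z y) = c))
    {w : T3 → V3} {b : V3} (hw : Torus.IsSmooth w) {U : Set T3} (hU : IsOpen U)
    (haU : ∀ x, a ≤ Torus.euclidDist x x₀ → x ∈ U) (hwU : ∀ x ∈ U, w x = b)
    (hdev : ScaleDeviationV w b r κ) (hm : m⁻¹ = 10 * r) (hr : 0 < r) :
    fieldD3V (fun y => w (Z y)) ≤ 27090300 * (κ * r) ^ 2 := by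
  have h10 : 0 < 10 * r := by positivity
  have P1 : ∀ y l, ‖Torus.partialDeriv l (fun y => w (Z y)) y‖ ≤ 10 * (κ * r) := by
    intro y l
    rw [(ap_zoom_derivsV hZv hw hU haU hwU y l l l).1, norm_smul, hm, Real.norm_of_nonneg h10.le]
    have h := ((hdev (Z y)).2 l l l).1
    calc 10 * r * ‖Torus.partialDeriv l w (Z y)‖ ≤ 10 * r * κ := by gcongr
      _ = 10 * (κ * r) := by ring
  have P2 : ∀ y i l, ‖Torus.partialDeriv i (Torus.partialDeriv l (fun y => w (Z y))) y‖ ≤ 100 * (κ * r) := by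
    intro y i l
    rw [(ap_zoom_derivsV hZv hw hU haU hwU y i l l).2.1, norm_smul, norm_smul, hm, Real.norm_of_nonneg h10.le]
    have h := ((hdev (Z y)).2 i l l).2.1
    calc 10 * r * (10 * r * ‖Torus.partialDeriv i (Torus.partialDeriv l w) (Z y)‖)
        ≤ 10 * r * (10 * r * (κ / r)) := by gcongr
      _ = 100 * (κ * r) := by field_simp; ring
  have P3 : ∀ y j i l,
      ‖Torus.partialDeriv j (Torus.partialDeriv i (Torus.partialDeriv l (fun y => w (Z y)))) y‖ ≤
        1000 * (κ * r) := by
    intro y j i l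
    rw [(ap_zoom_derivsV hZv hw hU haU hwU y j i l).2.2, norm_smul, norm_smul, norm_smul, hm,
      Real.norm_of_nonneg h10.le]
    have h := ((hdev (Z y)).2 j i l).2.2
    calc 10 * r * (10 * r * (10 * r *
          ‖Torus.partialDeriv j (Torus.partialDeriv i (Torus.partialDeriv l w)) (Z y)‖))
        ≤ 10 * r * (10 * r * (10 * r * (κ / r ^ 2))) := by gcongr
      _ = 1000 * (κ * r) := by field_simp; ring
  have I1 : ∀ l, ∫ y, ‖Torus.partialDeriv l (fun y => w (Z y)) y‖ ^ 2 ≤ 100 * (κ * r) ^ 2 := fun l =>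
    (ap_integral_norm_sq_le fun y => P1 y l).trans_eq (by ring)
  have I2 : ∀ i l, ∫ y, ‖Torus.partialDeriv i (Torus.partialDeriv l (fun y => w (Z y))) y‖ ^ 2 ≤
      10000 * (κ * r) ^ 2 := fun i l => (ap_integral_norm_sq_le fun y => P2 y i l).trans_eq (by ring)
  have I3 : ∀ j i l,
      ∫ y, ‖Torus.partialDeriv j (Torus.partialDeriv i (Torus.partialDeriv l (fun y => w (Z y)))) y‖ ^ 2 ≤
      1000000 * (κ * r) ^ 2 := fun j i l => (ap_integral_norm_sq_le fun y => P3 y j i l).trans_eq (by ring)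
  have S1 : ∑ l : Fin 3, ∫ y, ‖Torus.partialDeriv l (fun y => w (Z y)) y‖ ^ 2 ≤
      ∑ _l : Fin 3, 100 * (κ * r) ^ 2 := Finset.sum_le_sum fun l _ => I1 l
  have S2 : ∑ i : Fin 3, ∑ l : Fin 3, ∫ y, ‖Torus.partialDeriv i (Torus.partialDeriv l (fun y => w (Z y))) y‖ ^ 2 ≤
      ∑ _i : Fin 3, ∑ _l : Fin 3, 10000 * (κ * r) ^ 2 :=
    Finset.sum_le_sum fun i _ => Finset.sum_le_sum fun l _ => I2 i l
  have S3 : ∑ j : Fin 3, ∑ i : Fin 3, ∑ l : Fin 3,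
      ∫ y, ‖Torus.partialDeriv j (Torus.partialDeriv i (Torus.partialDeriv l (fun y => w (Z y)))) y‖ ^ 2 ≤
      ∑ _j : Fin 3, ∑ _i : Fin 3, ∑ _l : Fin 3, 1000000 * (κ * r) ^ 2 :=
    Finset.sum_le_sum fun j _ => Finset.sum_le_sum fun i _ => Finset.sum_le_sum fun l _ => I3 j i l
  simp only [Finset.sum_const, Finset.card_univ, Fintype.card_fin, nsmul_eq_mul, Nat.cast_ofNat] at S1 S2 S3
  unfold fieldD3V
  linarith

/-- **Zoomed data energy of a bubble.** For a zoom map `Z` obeying the scalar and vector first-order dictionaries of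
`ZoomHyp` at `(m, a, x₀)` with `m⁻¹ = 10 r` and `2r < a`, and smooth data `(ρ₀, u₀, θ₀)` equal to the constant state off
`B(x₀, 2r)` with `ScaleDeviation` bounds of slope `κ` at scale `r`, the derivative energy of the zoomed data is
`D3 ≤ 81270900 (κ r)²` (`3 × 27090300`). Registered helper of `stub_bubble`. -/
theorem ap_D3_zoom_le : ∀ {m a r κ ρbar θbar : ℝ} {ubar : V3} {x₀ : T3} {Z : T3 → T3} {ρ₀ θ₀ : T3 → ℝ}
    {u₀ : T3 → V3},
    (∀ (g : T3 → ℝ) (c : ℝ), Torus.IsSmooth g → (∀ x, a ≤ Torus.euclidDist x x₀ → g x = c) →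
      Torus.IsSmooth (fun y => g (Z y)) ∧
      (∀ y (i : Fin 3), Torus.partialDeriv i (fun y => g (Z y)) y = m⁻¹ * Torus.partialDeriv i g (Z y)) ∧
      (∀ y, m * a ≤ Torus.euclidDist y x₀ → g (Z y) = c)) →
    (∀ (w : T3 → V3) (c : V3), Torus.IsSmooth w → (∀ x, a ≤ Torus.euclidDist x x₀ → w x = c) →
      Torus.IsSmooth (fun y => w (Z y)) ∧
      (∀ y (i : Fin 3), Torus.partialDeriv i (fun y => w (Z y)) y = m⁻¹ • Torus.partialDeriv i w (Z y)) ∧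
      (∀ y, m * a ≤ Torus.euclidDist y x₀ → w (Z y) = c)) →
    Torus.IsSmooth ρ₀ → Torus.IsSmooth θ₀ → Torus.IsSmooth u₀ →
    (∀ x, 2 * r ≤ Torus.euclidDist x x₀ → ρ₀ x = ρbar ∧ θ₀ x = θbar ∧ u₀ x = ubar) →
    ScaleDeviation ρ₀ ρbar r κ → ScaleDeviation θ₀ θbar r κ → ScaleDeviationV u₀ ubar r κ →
    m⁻¹ = 10 * r → 0 < r → 2 * r < a →
    fieldD3 (fun y => ρ₀ (Z y)) + fieldD3V (fun y => u₀ (Z y)) + fieldD3 (fun y => θ₀ (Z y)) ≤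
      81270900 * (κ * r) ^ 2 := by
  intro m a r κ ρbar θbar ubar x₀ Z ρ₀ θ₀ u₀ hZs hZv hρ hθ hu hsupp hSρ hSθ hSu hm hr ha
  have hU : IsOpen {x : T3 | 2 * r < Torus.euclidDist x x₀} := ap_isOpen_far x₀ (2 * r)
  have haU : ∀ x, a ≤ Torus.euclidDist x x₀ → x ∈ {x : T3 | 2 * r < Torus.euclidDist x x₀} :=
    fun x hx => show 2 * r < Torus.euclidDist x x₀ from ha.trans_le hx
  have b1 := ap_fieldD3_zoom_le hZs hρ hU haU (fun x hx => (hsupp x (le_of_lt hx)).1) hSρ hm hr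
  have b2 := ap_fieldD3V_zoom_le hZv hu hU haU (fun x hx => (hsupp x (le_of_lt hx)).2.2) hSu hm hr
  have b3 := ap_fieldD3_zoom_le hZs hθ hU haU (fun x hx => (hsupp x (le_of_lt hx)).2.1) hSθ hm hr
  linarith

/-! ## Two arithmetic lemmas (guarded box, packing) -/

/-- State consequences of the weak `C⁰` bounds `|V - V̄| ≤ δ ≤ 1/(4M)` round a guarded constant state. -/
theorem ap_state {M ρbar θbar δ ρv θv : ℝ} {ubar uv : V3} (hM : 1 ≤ M)
    (h1 : M⁻¹ ≤ ρbar) (h2 : ρbar ≤ M) (h3 : M⁻¹ ≤ θbar) (h4 : θbar ≤ M) (h5 : ‖ubar‖ ≤ M)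
    (hδ : δ ≤ 1 / (4 * M)) (hρ : |ρv - ρbar| ≤ δ) (hθ : |θv - θbar| ≤ δ) (hu : ‖uv - ubar‖ ≤ δ) :
    (4 * M)⁻¹ ≤ ρv ∧ ρv ≤ 4 * M ∧ (4 * M)⁻¹ ≤ θv ∧ θv ≤ 4 * M ∧ ‖uv‖ ≤ 4 * M ∧
    θv ≤ M + 1 ∧ ‖uv‖ ≤ M + 1 ∧ ρv ≤ ρbar + 1 / (4 * M) ∧ 0 < ρv ∧ 0 < θv := by
  have hM0 : 0 < M := by linarith
  have hp0 : 0 < M⁻¹ := inv_pos.2 hM0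
  have hp1 : M⁻¹ ≤ 1 := inv_le_one_of_one_le₀ hM
  have e1 : (4 * M)⁻¹ = M⁻¹ / 4 := by rw [mul_inv]; ring
  have e2 : 1 / (4 * M) = M⁻¹ / 4 := by rw [one_div, mul_inv]; ring
  rw [abs_le] at hρ hθ
  have hn : ‖uv‖ - ‖ubar‖ ≤ ‖uv - ubar‖ := norm_sub_norm_le uv ubar
  rw [e1]
  rw [e2] at hδ
  refine ⟨by linarith, by linarith, by linarith, by linarith, by linarith, by linarith, by linarith,
    by linarith, by linarith, by linarith⟩

/-- Packing along the bootstrap: `(ρ̄ + 1/(4M)) σ³ ≤ (5/4) η` when `ρ̄ σ³ ≤ η` and `M⁻¹ ≤ ρ̄`. -/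
theorem ap_packing_base {M ρbar σ η : ℝ} (h1 : M⁻¹ ≤ ρbar) (hσ : 0 < σ)
    (hη : ρbar * σ ^ 3 ≤ η) : (ρbar + 1 / (4 * M)) * σ ^ 3 ≤ 5 / 4 * η := by
  have hs : 0 < σ ^ 3 := pow_pos hσ 3
  have h2 : M⁻¹ * σ ^ 3 ≤ ρbar * σ ^ 3 := mul_le_mul_of_nonneg_right h1 hs.le
  have e : (ρbar + 1 / (4 * M)) * σ ^ 3 = ρbar * σ ^ 3 + 1 / 4 * (M⁻¹ * σ ^ 3) := by
    rw [one_div, mul_inv]; ring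
  rw [e]
  linarith

/-! ## The trivial bubble (`κ = 0`) -/

/-- **The trivial bubble.** Data with `ScaleDeviation` bounds of slope `0` ARE the constant state, and the constant solution
(`IsHardSphereEulerSolutionDim.const`) is a classical solution with these data obeying all conclusions of `BubbleAtScale`. -/
theorem ap_bubble_const {σ T ρbar θbar r C : ℝ} {ubar : V3} {x₀ : T3} {ρ₀ θ₀ : T3 → ℝ} {u₀ : T3 → V3}
    (hρbar : 0 < ρbar) (hθbar : 0 < θbar) (hSρ : ScaleDeviation ρ₀ ρbar r 0) (hSθ : ScaleDeviation θ₀ θbar r 0)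
    (hSu : ScaleDeviationV u₀ ubar r 0) :
    ∃ (ρ θ : ℝ → T3 → ℝ) (u : ℝ → T3 → V3), IsHardSphereEulerSolution σ T ρ u θ ∧ ρ 0 = ρ₀ ∧ θ 0 = θ₀ ∧ u 0 = u₀ ∧
      (∀ s ∈ Set.Ico 0 T, ∀ x, |ρ s x - ρbar| ≤ C * 0 * r ∧ |θ s x - θbar| ≤ C * 0 * r ∧
        ‖u s x - ubar‖ ≤ C * 0 * r ∧ ∀ i : Fin 3, |Torus.partialDeriv i (ρ s) x| ≤ C * 0 ∧
          ‖Torus.partialDeriv i (u s) x‖ ≤ C * 0 ∧ |Torus.partialDeriv i (θ s) x| ≤ C * 0) ∧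
      (∀ s ∈ Set.Ico 0 T, ∀ x, 4 * r ≤ Torus.euclidDist x x₀ → ρ s x = ρbar ∧ θ s x = θbar ∧ u s x = ubar) := by
  have eρ : ρ₀ = fun _ => ρbar := funext fun x => by
    have h := (hSρ x).1
    rwa [zero_mul, abs_nonpos_iff, sub_eq_zero] at h
  have eθ : θ₀ = fun _ => θbar := funext fun x => by
    have h := (hSθ x).1
    rwa [zero_mul, abs_nonpos_iff, sub_eq_zero] at h
  have eu : u₀ = fun _ => ubar := funext fun x => by
    have h := (hSu x).1
    rwa [zero_mul, norm_le_zero_iff, sub_eq_zero] at h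
  subst eρ eθ eu
  have hsol : IsHardSphereEulerSolution σ T (fun _ _ => ρbar) (fun _ _ => ubar) (fun _ _ => θbar) :=
    isHardSphereEulerSolutionDim_three_iff.1 (IsHardSphereEulerSolutionDim.const σ T ubar hρbar hθbar)
  have zR : ∀ (i : Fin 3) (x : T3), Torus.partialDeriv i (fun _ : T3 => ρbar) x = 0 := fun i x =>
    ap_partialDeriv_eq_zero_of_isOpen isOpen_univ (fun _ _ => rfl) i x (mem_univ x)
  have zΘ : ∀ (i : Fin 3) (x : T3), Torus.partialDeriv i (fun _ : T3 => θbar) x = 0 := fun i x =>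
    ap_partialDeriv_eq_zero_of_isOpen isOpen_univ (fun _ _ => rfl) i x (mem_univ x)
  have zU : ∀ (i : Fin 3) (x : T3), Torus.partialDeriv i (fun _ : T3 => ubar) x = 0 := fun i x =>
    ap_partialDeriv_eq_zero_of_isOpen isOpen_univ (fun _ _ => rfl) i x (mem_univ x)
  refine ⟨fun _ _ => ρbar, fun _ _ => θbar, fun _ _ => ubar, hsol, rfl, rfl, rfl, fun s _ x => ?_,
    fun s _ x _ => ⟨rfl, rfl, rfl⟩⟩
  refine ⟨by simp, by simp, by simp, fun i => ?_⟩
  rw [zR i x, zU i x, zΘ i x, abs_zero, norm_zero, mul_zero]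
  exact ⟨le_rfl, le_rfl, le_rfl⟩

end Summit.AtomisticToContinuum.HydrodynamicLimit.Theorems.ConeLocalisation.Bubble

end
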